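import Literature.MathematicalPhysics.QuantumFieldTheory.Balaban1983to89.B6DomainMajorant
import Literature.MathematicalPhysics.QuantumFieldTheory.Balaban1983to89.B6RandomWalkHom

/-!
# `Balaban1983to89.B6DomainMajorantSandwich` — the third line of (2.82) ON 𝔅: the Q′-sandwich, block-constant
cuts, and the 𝔅-kernel of `□Q′(G′(□̃)² − G′²)Q′*h_□` (B6 = T. Bałaban, *Propagators and renormalization
transformations for lattice gauge theories. II*, Commun. Math. Phys. **96**, 223–250 (1984) [Balaban1984PropagatorsII],
pp. 225, 232, 237–238)

CITATION HEADER (lean-in-tree rule 2026-08-18).  Cell `pub-balaban`, unit `b2b-balaban-b06-g9` (PAPER SUB-CELL B06,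
gen 9 — the owner lineage of `…B6`, `…B6KernelComposition`, `…B6WeightedEncoding`, `…B6Ineq268`, `…B6Ineq283`,
`…B6DomainChange`, `…B6DomainTerm282`, `…B6DomainMajorant`); journal claim B6-LINE3-SANDWICH; cell rows GAPS
C-b06g9-3, DIVERGENCE D-b06.21b.  Source: doi:10.1007/bf01240221, held `paper:balaban1984-cmp96-propagators-rt-ii`;
journal page = PDF page + 222.  Every quotation below was read this session from the page renders
`b2b-balaban-ref1/pages/1984-cmp96-propagators-rt-II/1984-cmp96-propagators-rt-II-p003-x2.png` (p. 225),
`…-p015-x2.png` (p. 237) and `…-p016-x2.png` (p. 238) AS IMAGES, not from an OCR layer.  No existing module is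
modified: this module imports `…B6DomainMajorant` (this lineage; the fine-lattice majorant of the cut difference of
squares, `line3_deep_majorant_lemma21`) and the sibling `…B6RandomWalkHom` (the two-space majorant vocabulary
`HasMajorantHom`, `hasMajorantHom_comp` of (2.52)/(2.55) between two function spaces) and touches nothing else.

THE PRINTED TEXT (verbatim).
* p. 225 [PDF 3]: *"Δ′_a = Δ + Q′\*aQ′"*; *"⟨ω, Q′λ⟩ = Σ_{j=0}^{k} Σ_{y∈Λ_j} (L^jη)^d ω(y)(Q′_jλ)(y)"*; *"we assume that
  (Q′₀λ)(x) = λ(x), x ∈ Λ₀"*; *"The operator G′ = Δ′_a^{−1} is a well defined, positive operator"*.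
* p. 237 [PDF 15], (2.82): *"Q′G′²Q′\*C = Σ_{□∈𝒟} Q′G′²Q′\*h_□C_□h_□ = Σ_□ h_□(□Q′G′(□̃)²Q′\*□)C_□h_□
  − Σ_□ [h_□, □Q′G′(□̃)²Q′\*□]C_□h_□ − Σ_□ □Q′(G′(□̃)² − G′²)Q′\*h_□C_□h_□ − Σ_{□,□′≠□} (□ − 1)h²_{□′}Q′G′²Q′\*h_□C_□h_□
  = I − Σ_{□,□′} R_{□,□′}C_{□′}h_{□′} = I − R"*; *"We have to estimate the norm of R in the space L²(𝔅)."*; (2.83),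
  first and second member: *"|(□′ − 1)(y)h²_□(y) Σ_{y″∈supp h_{□′}} (L^{j′}η)^d (Q′G′²Q′\*)(y, y″)h_{□′}(y″)C_{□′}(y″, y′)
  h_{□′}(y′)| ≤ O(1)(L^jη)⁴ Σ_{y″∈supp h_{□′}} e^{−½δ₀d(y,y″)} c₁ (L^{j′}η)^{−d−4} e^{−δ₁(L^{j′}η)^{−1}|y″−y′|}"*.
* p. 238 [PDF 16]: *"Similar inequalities hold for kernels of the other operators forming R, for example the operator
  with G′(□̃)² − G′² is small and an estimate has the factor e^{−δ₀M} because of the usual estimate of the type (1.12)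
  [3] connected with a change of a domain. This estimate follows from the random walk representations (2.50) for the
  operators G′, G′(□̃). An estimate of the terms with the commutator is even simpler and gives a factor O(M^{−1})."*

THE READING (typed objects; every choice is recorded in the cell's DIVERGENCE D-b06.21b).
(a) TWO LATTICES.  The sibling `…B6DomainMajorant` bounds the FINE-LATTICE operator `cL·(G′(□̃)² − G′²)·cR`
    (operators on `X → ℝ`, X the fine lattice with the block map `blk` = y(·) of p. 231, cuts cL, cR functions on X)
    by a 𝔅-block majorant (`B6RandomWalk.HasMajorant`).  The printed third-line operator `□Q′(G′(□̃)² − G′²)Q′\*h_□`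
    acts on the functions on 𝔅 = `g.Site` (the multiscale set of blocks, on which Q′ takes values and C_□, h_□, □
    live: *"the norm of R in the space L²(𝔅)"*), with the cuts □ (the indicator of the cube, a function on 𝔅) and
    h_□ OUTSIDE the sandwich Q′ ⋯ Q′\*.
(b) Q′ AND Q′\* AS TWO-SPACE OPERATORS with DIAGONAL majorants: Q′ ≺ c_Q·1_{y=y′} ((Q′λ)(y) depends on λ|_{B(y)}
    only and is bounded by c_Q·sup|λ|) and Q′\* ≺ c_{Q\*}·1_{y=y′} — HYPOTHESES `hQ`, `hQs` in the abstract theorems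
    (the convention of the B9 twin `B9Eq395Hom.sandwich_majorant`, stated there over a transported B9 geometry), and
    PROVED here (c_Q = c_{Q\*} = 1) for the generic normalised block average `avgOp blk w`,
    (Q′λ)(y) = Σ_{x∈B(y)} w(x)λ(x) with w ≥ 0, Σ_{B(y)} w ≤ 1 (the printed Q′_j: w = η^d(L^jη)^{−d} on B^j(y); Q′₀ = the
    identity on Λ₀), and for the pull-back `pullOp blk`, (Q′\*ω)(x) = ω(y(x)) (the adjoint of the normalised average for
    the pairing of p. 225 with the weights (L^jη)^d on 𝔅 and η^d on T_η — our reading of Q′\*).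
(c) CUT TRANSPORT: χ·Q′ = Q′·(χ∘y) and Q′\*·h = (h∘y)·Q′\* (HYPOTHESES `hQχ`, `hQsh`; exact identities for
    `avgOp`/`pullOp`: a multiplier on 𝔅 passes through as the BLOCK-CONSTANT multiplier on X), hence
    `□·(Q′TQ′\*)·h_□ = Q′·((□∘y)·T·(h_□∘y))·Q′\*` (`cut_sandwich_eq`) and the sibling's theorem applies with
    cL = □∘y, cR = h_□∘y.
(d) KERNEL CONVENTION: `B9Thm34Inv.entry T y y′ = T(δ_{y′})(y)`.  With the pairing weight (L^{j′}η)^d of p. 225,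
    (Tω)(y) = Σ_{y′} entry T y y′ · ω(y′) = Σ_{y′} (L^{j′}η)^d T(y, y′) ω(y′), so `entry` is the product
    *"(L^{j′}η)^d (Q′ ⋯ Q′\*)(y, y″)"* that appears in the first member of (2.83): an `entry` bound IS a bound of the
    printed summand.
(e) RATES AND CONSTANTS are the sibling's: weight (L^jη)⁴ at the OUTPUT block (the printed (L^jη)⁴ of (2.83)), rate
    (δ − α′δ₀)/6 in place of the printed ½δ₀, domain-change factor e^{−((δ−α′δ₀)/3)M₀} (M₀ = the distance of the cuts
    from the zone where the cut-off χ of the sibling varies) in place of the printed e^{−δ₀M}; constant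
    c_Qc_{Q\*}·L²·Ctot.  A typing divergence (D-b06.21/21a/21b), not a claim about the print.

WHAT THIS MODULE PROVES (kernel-checked; no `sorry`, no axiom beyond Lean's three):
1. §1 — `pullOp`, `avgOp` (+ `_apply`); `hasMajorantHom_pullOp`, `hasMajorantHom_avgOp` (the diagonal two-space
   majorants 1_{y=y′}); `pullOp_comp_mulOp`, `mulOp_comp_avgOp` (cut transport).
2. §2 — `cut_sandwich_eq`; `q_sandwich_majorant` (Q′MQ′\* ≺ c_Qc_{Q\*}K on 𝔅 from
   M ≺ K ≥ 0 on X — `hasMajorantHom_comp` twice, the diagonal majorants collapsing the y″-sums; the `B6.Geometry` twin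
   of `B9Eq395Hom.sandwich_majorant`); `entry_le_of_hasMajorant_id` (a majorant on 𝔅 with the identity block map is
   an entrywise bound — the `B6.Geometry` form of `B9Thm34Inv.hasMajorant_id_iff`, forward direction);
   `entry_mul_le_of_majorant` (|(A·C·h)(y,y′)| ≤ Σ_{y″}K(y,y″)|C(y″,y′)||h(y′)| from A ≺ K).
3. §3 — `line3_term_majorant`: under the hypotheses of `B6DomainMajorant.line3_deep_majorant_lemma21` ((2.60), (2.61),
   L ≥ 1, RM ≥ 0, α′δ₀ ≥ 0, the located size condition L²e^{−α′δ₀RM} ≤ 1, the zone N ≠ ∅ with χ = 1 off N, the cut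
   algebra GD = DG = 1, χDG′(□̃) = χ = G′(□̃)Dχ, the (2.67)₁-type majorants B₁(L^jη)²e^{−δd} of G′ and G′(□̃), the zone
   majorants 1_N(y)θe^{−δd} of [χ,D]G′(□̃) and [χ,D]G′, α′δ₀ < δ) with the cuts now FUNCTIONS ON 𝔅 — `sq` (□) and
   `hh` (h_□), |·| ≤ 1, inside {χ = 1} (`hsqχ`, `hhχ`), supported at distance ≥ M₀ from N — and (b), (c):
   `□Q′(G′(□̃)² − G′²)Q′\*h_□ ≺ c_Qc_{Q\*}·L²(L^jη)⁴·Ctot(profileK, B₁, θ, δ−α′δ₀)·e^{−((δ−α′δ₀)/3)M₀}·e^{−((δ−α′δ₀)/6)d(y,y′)}`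
   on 𝔅; `line3_term_entry_le` (the same as an `entry` bound, (d)); `line3_R_entry_le` (the (2.83)-type step
   member 1 ⇒ member 2 for the FULL third-line term `□Q′(G′(□̃)² − G′²)Q′\*h_□·C_□h_□`:
   ≤ const·Σ_{y″} e^{−((δ−α′δ₀)/6)d(y,y″)}|C_□(y″,y′)||h_□(y′)|, any C); `line3_term_majorant_avg` (the concrete
   instance Q′ = `avgOp blk w`, Q′\* = `pullOp blk`: `hQ`, `hQs`, `hQχ`, `hQsh` discharged by name, c_Q = c_{Q\*} = 1).

WHAT IT DOES NOT PROVE (NAMED hypotheses of printed shape, or not modelled): everything in the SCOPE list of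
`…B6DomainMajorant` (the (2.67)₁-type majorants of G′, G′(□̃), the zone majorants of the commutator products from
(2.67)₂,₃ and the slope of the cut-off, the cut algebra for B6's Δ′_a and G′(□̃) — hypotheses; Lemma 2.1 itself —
`Ineq260/261` are hypotheses); (2.81) for C_□ and the continuation members 2 ⇒ 5 of the (2.83)-type chain (the cell's
`…B6Ineq283`, to be run at the rate (δ−α′δ₀)/6 in place of ½δ₀); the identification of B6's Q′_j, Q′\* with
`avgOp`/`pullOp` and of `entry` with the printed kernel times (L^{j′}η)^d (readings (b), (d) of p. 225); the norm
bounds (2.84)–(2.85) and Proposition 2.3 (`…B6Cor28`, `…QGQInverse`, C-adv4-40).  Value = kernel certificate that the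
sibling's fine-lattice majorant is, after the Q′-sandwich and the cut transport, a bound of the printed 𝔅-kernel of
the third line of (2.82) with the domain-change factor — NOT summit progress.
-/

namespace Literature.MathematicalPhysics.QuantumFieldTheory.Balaban1983to89.B6DomainMajorantSandwich

open Finset Real
open B4Sect5Torus (IsPseudoDist)
open B6RandomWalk (HasMajorant BlockSupp hasMajorant_mono)
open B6RandomWalkHom (HasMajorantHom hasMajorantHom_comp hasMajorantHom_mono hasMajorantHom_iff)
open B9Thm37Sum (mulOp mulOp_apply)
open B9Thm34Inv (entry entry_mul)
open B6DomainMajorant (Ctot Ctot_nonneg profileK profileK_nonneg)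

/-! ## §1  Q′\* as the pull-back to the blocks, Q′ as a normalised block average (generic shape) -/

section Ops

variable {g : B6.Geometry} {X : Type}

/-- THE PULL-BACK `(Q′\*ω)(x) = ω(y)` for x in the block of y — the adjoint of a normalised block average with respect
to the pairing *"⟨ω, Q′λ⟩ = Σ_{j=0}^{k} Σ_{y∈Λ_j} (L^jη)^d ω(y)(Q′_jλ)(y)"* (p. 225) on 𝔅 and η^dΣ_x on T_η (our reading
of Q′\*; the identification with the print is the cell's DIVERGENCE row, the operator below is generic).
[cite: Balaban1984PropagatorsII, (2.15) p.225] -/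
def pullOp (blk : X → g.Site) : (g.Site → ℝ) →ₗ[ℝ] (X → ℝ) where
  toFun ω := fun x => ω (blk x)
  map_add' _ _ := rfl
  map_smul' _ _ := rfl

/-- (Q′\*ω)(x) = ω(y(x)) (definitional unfolding of `pullOp`). [folklore] -/
@[simp] theorem pullOp_apply (blk : X → g.Site) (ω : g.Site → ℝ) (x : X) : pullOp blk ω x = ω (blk x) := rfl

/-- Q′\* has the DIAGONAL two-space majorant 1_{y=y′}: a function supported at the site y′ of 𝔅 with |ω| ≤ B pulls
back to a function supported in the block of y′ with |·| ≤ B. [cite: Balaban1984PropagatorsII, (2.51)–(2.52) p.232] -/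
theorem hasMajorantHom_pullOp [DecidableEq g.Site] (blk : X → g.Site) :
    HasMajorantHom (fun y : g.Site => y) blk (pullOp blk) (fun a b => if a = b then (1 : ℝ) else 0) := by
  intro y' ω B hω x
  show |ω (blk x)| ≤ (if blk x = y' then (1 : ℝ) else 0) * B
  by_cases hx : blk x = y'
  · rw [if_pos hx, one_mul]
    exact hω.bound (blk x) hx
  · rw [if_neg hx, zero_mul, hω.off (blk x) hx, abs_zero]

/-- Q′\* commutes with multipliers: Q′\*·h = (h∘y(·))·Q′\* — a multiplier on 𝔅 pulls back to the BLOCK-CONSTANT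
multiplier on the fine lattice. [folklore] -/
theorem pullOp_comp_mulOp (blk : X → g.Site) (h : g.Site → ℝ) :
    pullOp blk ∘ₗ (mulOp h : Module.End ℝ (g.Site → ℝ)) =
      (mulOp (h ∘ blk) : Module.End ℝ (X → ℝ)) ∘ₗ pullOp blk := by
  refine LinearMap.ext fun ω => funext fun x => ?_
  simp only [LinearMap.comp_apply, pullOp_apply, mulOp_apply, Function.comp]

variable [Fintype X] [DecidableEq g.Site]

/-- THE NORMALISED BLOCK AVERAGE `(Q′λ)(y) = Σ_{x ∈ B(y)} w(x)λ(x)` with weights w (for the printed Q′_j: w = η^d(L^jη)^{−d}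
on B^j(y), *"(Q′₀λ)(x) = λ(x), x ∈ Λ₀"*, p. 225; generic here, the weights are a parameter).
[cite: Balaban1984PropagatorsII, (2.14)–(2.15) p.225] -/
def avgOp (blk : X → g.Site) (w : X → ℝ) : (X → ℝ) →ₗ[ℝ] (g.Site → ℝ) where
  toFun μ := fun y => ∑ x : X, if blk x = y then w x * μ x else 0
  map_add' μ ν := by
    funext y
    simp only [Pi.add_apply]
    rw [← Finset.sum_add_distrib]
    refine Finset.sum_congr rfl fun x _ => ?_
    split_ifs <;> ring
  map_smul' r μ := by
    funext y
    simp only [Pi.smul_apply, smul_eq_mul, RingHom.id_apply, Finset.mul_sum]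
    refine Finset.sum_congr rfl fun x _ => ?_
    split_ifs <;> ring

/-- (Q′μ)(y) = Σ_{x : y(x) = y} w(x)μ(x) (definitional unfolding of `avgOp`). [folklore] -/
@[simp] theorem avgOp_apply (blk : X → g.Site) (w : X → ℝ) (μ : X → ℝ) (y : g.Site) :
    avgOp blk w μ y = ∑ x : X, if blk x = y then w x * μ x else 0 := rfl

/-- A normalised block average (w ≥ 0, Σ_{x∈B(y)} w(x) ≤ 1) has the DIAGONAL two-space majorant 1_{y=y′}:
|(Q′λ)(y)| ≤ sup_{B(y)}|λ| and (Q′λ)(y) depends on λ|_{B(y)} only. [cite: Balaban1984PropagatorsII, (2.51)–(2.52) p.232] -/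
theorem hasMajorantHom_avgOp (blk : X → g.Site) {w : X → ℝ} (hw0 : ∀ x, 0 ≤ w x)
    (hw1 : ∀ y : g.Site, (∑ x : X, if blk x = y then w x else 0) ≤ 1) :
    HasMajorantHom blk (fun y : g.Site => y) (avgOp blk w) (fun a b => if a = b then (1 : ℝ) else 0) := by
  intro y' μ B hμ y
  show |∑ x : X, (if blk x = y then w x * μ x else 0)| ≤ (if y = y' then (1 : ℝ) else 0) * B
  by_cases hy : y = y'
  · rw [if_pos hy, one_mul]
    calc |∑ x : X, (if blk x = y then w x * μ x else 0)|
        ≤ ∑ x : X, |(if blk x = y then w x * μ x else 0)| := Finset.abs_sum_le_sum_abs _ _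
      _ ≤ ∑ x : X, (if blk x = y then w x else 0) * B := Finset.sum_le_sum fun x _ => by
          split_ifs with hx
          · rw [abs_mul, abs_of_nonneg (hw0 x)]
            exact mul_le_mul_of_nonneg_left (hμ.bound x (hx.trans hy)) (hw0 x)
          · rw [abs_zero, zero_mul]
      _ = (∑ x : X, if blk x = y then w x else 0) * B := (Finset.sum_mul _ _ _).symm
      _ ≤ 1 * B := mul_le_mul_of_nonneg_right (hw1 y) hμ.nonneg
      _ = B := one_mul B
  · rw [if_neg hy, zero_mul]
    have h0 : ∑ x : X, (if blk x = y then w x * μ x else 0) = 0 := Finset.sum_eq_zero fun x _ => by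
      split_ifs with hx
      · rw [hμ.off x (fun h => hy (hx.symm.trans h)), mul_zero]
      · rfl
    rw [h0, abs_zero]

/-- Multipliers on 𝔅 commute with the block average into BLOCK-CONSTANT multipliers on the fine lattice:
χ·Q′ = Q′·(χ∘y(·)) (so □Q′ = Q′□ for a union of blocks □). [folklore] -/
theorem mulOp_comp_avgOp (blk : X → g.Site) (w : X → ℝ) (χ : g.Site → ℝ) :
    (mulOp χ : Module.End ℝ (g.Site → ℝ)) ∘ₗ avgOp blk w =
      avgOp blk w ∘ₗ (mulOp (χ ∘ blk) : Module.End ℝ (X → ℝ)) := by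
  refine LinearMap.ext fun μ => funext fun y => ?_
  simp only [LinearMap.comp_apply, mulOp_apply, avgOp_apply, Function.comp, Finset.mul_sum]
  refine Finset.sum_congr rfl fun x _ => ?_
  split_ifs with hx
  · rw [hx]
    ring
  · rw [mul_zero]

end Ops

/-! ## §2  The sandwich Q′MQ′\* on 𝔅 from M on the fine lattice ((2.52) through the two lattices) -/

section Sandwich

variable {g : B6.Geometry} {X : Type}

/-- **Cuts move through the sandwich**: if χ·Q′ = Q′·(χ∘y) and Q′\*·h = (h∘y)·Q′\* (by name for `avgOp`/`pullOp`:
`mulOp_comp_avgOp`, `pullOp_comp_mulOp`), then χ·(Q′TQ′\*)·h = Q′·((χ∘y)·T·(h∘y))·Q′\* — the cuts □, h_□ of the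
third line of (2.82) act on the fine-lattice operator G′(□̃)² − G′² as block-constant cuts. [folklore] -/
theorem cut_sandwich_eq (blk : X → g.Site) {Qp : (X → ℝ) →ₗ[ℝ] (g.Site → ℝ)} {Qs : (g.Site → ℝ) →ₗ[ℝ] (X → ℝ)}
    (T : Module.End ℝ (X → ℝ)) {χ h : g.Site → ℝ}
    (hQχ : (mulOp χ : Module.End ℝ (g.Site → ℝ)) ∘ₗ Qp = Qp ∘ₗ (mulOp (χ ∘ blk) : Module.End ℝ (X → ℝ)))
    (hQsh : Qs ∘ₗ (mulOp h : Module.End ℝ (g.Site → ℝ)) = (mulOp (h ∘ blk) : Module.End ℝ (X → ℝ)) ∘ₗ Qs) :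
    mulOp χ * (Qp ∘ₗ T ∘ₗ Qs) * mulOp h = Qp ∘ₗ (mulOp (χ ∘ blk) * T * mulOp (h ∘ blk)) ∘ₗ Qs := by
  have h1 : ∀ u : X → ℝ, mulOp χ (Qp u) = Qp (mulOp (χ ∘ blk) u) := fun u => by
    simpa using LinearMap.congr_fun hQχ u
  have h2 : ∀ f : g.Site → ℝ, Qs (mulOp h f) = mulOp (h ∘ blk) (Qs f) := fun f => by
    simpa using LinearMap.congr_fun hQsh f
  refine LinearMap.ext fun f => ?_
  simp only [Module.End.mul_apply, LinearMap.comp_apply, h1, h2]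

variable [DecidableEq g.Site]

/-- **Q′MQ′\* on 𝔅 from M on the fine lattice** — the `B6.Geometry` twin of `B9Eq395Hom.sandwich_majorant` (stated
there over a transported B9 geometry): Q′ with the two-space majorant c_Q·1_{y=y′} (HYPOTHESIS `hQ`; by name for a
normalised block average, `hasMajorantHom_avgOp`), Q′\* with c_{Q\*}·1_{y=y′}, c_{Q\*} ≥ 0 (HYPOTHESIS `hQs`;
`hasMajorantHom_pullOp`), and M ≺ K ≥ 0 on the fine lattice give Q′MQ′\* ≺ c_Qc_{Q\*}K on 𝔅 — two applications of
(2.52) ⇒ (2.55) through the middle lattice (`B6RandomWalkHom.hasMajorantHom_comp`), the diagonal majorants collapsing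
both y″-sums. [cite: Balaban1984PropagatorsII, (2.52)–(2.55) p.232] -/
theorem q_sandwich_majorant (blk : X → g.Site) (cQ cQs : ℝ) (hcQs : 0 ≤ cQs)
    {Qp : (X → ℝ) →ₗ[ℝ] (g.Site → ℝ)} {Qs : (g.Site → ℝ) →ₗ[ℝ] (X → ℝ)} {Mf : Module.End ℝ (X → ℝ)}
    {K : g.Site → g.Site → ℝ} (hK : ∀ a b, 0 ≤ K a b)
    (hQ : HasMajorantHom blk (fun y : g.Site => y) Qp (fun (a b : g.Site) => cQ * (if a = b then (1 : ℝ) else 0)))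
    (hQs : HasMajorantHom (fun y : g.Site => y) blk Qs (fun (a b : g.Site) => cQs * (if a = b then (1 : ℝ) else 0)))
    (hM : HasMajorant blk Mf K) :
    HasMajorant (fun y : g.Site => y) (Qp ∘ₗ Mf ∘ₗ Qs) (fun (a b : g.Site) => cQ * cQs * K a b) := by
  have hMh : HasMajorantHom blk blk Mf K := (hasMajorantHom_iff blk Mf K).mpr hM
  have hδ : ∀ a b : g.Site, 0 ≤ cQs * (if a = b then (1 : ℝ) else 0) := fun a b =>
    mul_nonneg hcQs (by split_ifs <;> norm_num)
  have hMQs : HasMajorantHom (fun y : g.Site => y) blk (Mf ∘ₗ Qs) (fun (a b : g.Site) => cQs * K a b) := by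
    have h := hasMajorantHom_comp (fun y : g.Site => y) blk blk hMh hQs hδ
    refine hasMajorantHom_mono _ _ h fun (a b : g.Site) => ?_
    rw [Finset.sum_eq_single b (fun y'' _ hne => by rw [if_neg hne]; ring)
      (fun h => absurd (Finset.mem_univ b) h), if_pos rfl]
    exact le_of_eq (by ring)
  have hK' : ∀ a b : g.Site, 0 ≤ cQs * K a b := fun a b => mul_nonneg hcQs (hK a b)
  have h2 := hasMajorantHom_comp (fun y : g.Site => y) blk (fun y : g.Site => y) hQ hMQs hK'
  refine (hasMajorantHom_iff (fun y : g.Site => y) _ _).mp ?_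
  refine hasMajorantHom_mono _ _ h2 fun (a b : g.Site) => ?_
  rw [Finset.sum_eq_single a (fun y'' _ hne => by rw [if_neg (fun h => hne h.symm)]; ring)
    (fun h => absurd (Finset.mem_univ a) h), if_pos rfl]
  exact le_of_eq (by ring)

/-- For operators on the functions on 𝔅 (block map the identity) a majorant IS an entrywise kernel bound:
|T(δ_{y′})(y)| ≤ K(y, y′) (the `B6.Geometry` form of `B9Thm34Inv.hasMajorant_id_iff`, forward direction).
[cite: Balaban1984PropagatorsII, (2.51) p.232] -/
theorem entry_le_of_hasMajorant_id {T : Module.End ℝ (g.Site → ℝ)} {K : g.Site → g.Site → ℝ}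
    (h : HasMajorant (fun y : g.Site => y) T K) (y y' : g.Site) : |entry T y y'| ≤ K y y' := by
  have hs : BlockSupp (g := g) (fun x : g.Site => x) (Pi.single y' (1 : ℝ)) y' 1 :=
    ⟨zero_le_one, fun x (hx : x = y') => by rw [hx]; simp, fun x (hx : x ≠ y') => by
      simp [Pi.single_eq_of_ne hx]⟩
  simpa [entry] using h y' _ 1 hs y

/-- THE (2.83)-TYPE FIRST STEP for a product A·(C·h): |(A·C·h)(y,y′)| ≤ Σ_{y″}K(y,y″)|C(y″,y′)||h(y′)| from A ≺ K
on 𝔅 (kernel language: `entry`). [cite: Balaban1984PropagatorsII, (2.83) p.237] -/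
theorem entry_mul_le_of_majorant {A C : Module.End ℝ (g.Site → ℝ)} {K : g.Site → g.Site → ℝ}
    (hA : HasMajorant (fun y : g.Site => y) A K) (h : g.Site → ℝ) (y y' : g.Site) :
    |entry (A * (C * mulOp h)) y y'| ≤ ∑ y'' : g.Site, K y y'' * (|entry C y'' y'| * |h y'|) := by
  rw [entry_mul]
  refine (Finset.abs_sum_le_sum_abs _ _).trans (Finset.sum_le_sum fun y'' _ => ?_)
  rw [abs_mul, B6DomainTerm282.entry_mul_mulOp, abs_mul]
  exact mul_le_mul_of_nonneg_right (entry_le_of_hasMajorant_id hA y y'') (by positivity)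

end Sandwich

/-! ## §3  The third line of (2.82): `□Q′(G′(□̃)² − G′²)Q′*h_□` on 𝔅 -/

section Line3

variable {g : B6.Geometry} [DecidableEq g.Site] {X : Type}

/-- **THE 𝔅-MAJORANT OF THE THIRD-LINE OPERATOR `□Q′(G′(□̃)² − G′²)Q′*h_□` OF (2.82)** (p. 237: *"− Σ_□ □Q′(G′(□̃)² −
G′²)Q′\*h_□C_□h_□"*).  Everything of `B6DomainMajorant.line3_deep_majorant_lemma21` ((2.60), (2.61), the located
size condition L²e^{−α′δ₀RM} ≤ 1, the zone N ≠ ∅ of the cut-off χ with χ = 1 off N, the cut algebra GD = DG = 1,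
χDG′(□̃) = χ = G′(□̃)Dχ, the four majorants, α′δ₀ < δ), with the two cuts now FUNCTIONS ON 𝔅 — `sq` (the printed □)
and `hh` (the printed h_□), |·| ≤ 1, inside the region where χ = 1 (`hsqχ`, `hhχ`) and supported at distance ≥ M₀
from the zone — plus Q′ ≺ c_Q1_{y=y′}, Q′\* ≺ c_{Q\*}1_{y=y′} (c_{Q\*} ≥ 0) commuting with the cuts into
block-constant cuts (`hQχ`, `hQsh`), give
`□Q′(G′(□̃)² − G′²)Q′*h_□ ≺ c_Qc_{Q*}·L²(L^jη)⁴·C_tot·e^{−((δ−α′δ₀)/3)M₀}·e^{−((δ−α′δ₀)/6)d(y,y′)}` on 𝔅 — the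
factors (L^jη)⁴e^{−δ′d} of the second member of (2.83) times the domain-change factor (p. 238: *"the operator
with G′(□̃)² − G′² is small and an estimate has the factor e^{−δ₀M} because of the usual estimate of the type (1.12)
[3] connected with a change of a domain"*).  OURS (readings (a)–(e) of the header; the cell's D-b06.21b).
[cite: Balaban1984PropagatorsII, (2.82)–(2.83) p.237 + p.238] -/
theorem line3_term_majorant (blk : X → g.Site) (hρ : IsPseudoDist g.dist) {d : ℕ} {δ₀ α α' : ℝ}
    (h260 : B6RandomWalk.Ineq260 g δ₀ α') (h261 : B6RandomWalk.Ineq261 d g δ₀ α)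
    (hα' : 0 ≤ α' * δ₀) (hRM : 0 ≤ g.R * g.M) (hL : 1 ≤ g.L)
    (hsize : g.L ^ 2 * Real.exp (-(α' * δ₀ * (g.R * g.M))) ≤ 1)
    (N : Finset g.Site) (hN : N.Nonempty)
    {δ B₁ θ : ℝ} (hκδ : α' * δ₀ < δ) (hB₁ : 0 ≤ B₁) (hθ : 0 ≤ θ)
    {G D Gw : Module.End ℝ (X → ℝ)} {χ : X → ℝ} {sq hh : g.Site → ℝ}
    (hχ1 : ∀ x, |χ x| ≤ 1) (hsq1 : ∀ y, |sq y| ≤ 1) (hh1 : ∀ y, |hh y| ≤ 1)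
    (hsqχ : ∀ x, sq (blk x) * χ x = sq (blk x)) (hhχ : ∀ x, χ x * hh (blk x) = hh (blk x))
    (hχN : ∀ x, blk x ∉ N → χ x = 1)
    (hGD : G * D = 1) (hDG : D * G = 1)
    (hχGw : mulOp χ * D * Gw = mulOp χ) (hGwχ : Gw * D * mulOp χ = mulOp χ)
    (hG : HasMajorant blk G (fun a b => B₁ * g.len a ^ 2 * Real.exp (-(δ * g.dist a b))))
    (hGw : HasMajorant blk Gw (fun a b => B₁ * g.len a ^ 2 * Real.exp (-(δ * g.dist a b))))
    (hKGw : HasMajorant blk ((mulOp χ * D - D * mulOp χ) * Gw)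
      (fun a b => (if a ∈ N then θ else 0) * Real.exp (-(δ * g.dist a b))))
    (hKG : HasMajorant blk ((mulOp χ * D - D * mulOp χ) * G)
      (fun a b => (if a ∈ N then θ else 0) * Real.exp (-(δ * g.dist a b))))
    {M₀ : ℝ} (hsqdeep : ∀ y, sq y ≠ 0 → ∀ n ∈ N, M₀ ≤ g.dist y n)
    (hhdeep : ∀ y, hh y ≠ 0 → ∀ n ∈ N, M₀ ≤ g.dist y n)
    {Qp : (X → ℝ) →ₗ[ℝ] (g.Site → ℝ)} {Qs : (g.Site → ℝ) →ₗ[ℝ] (X → ℝ)} {cQ cQs : ℝ} (hcQs : 0 ≤ cQs)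
    (hQ : HasMajorantHom blk (fun y : g.Site => y) Qp (fun (a b : g.Site) => cQ * (if a = b then (1 : ℝ) else 0)))
    (hQs : HasMajorantHom (fun y : g.Site => y) blk Qs (fun (a b : g.Site) => cQs * (if a = b then (1 : ℝ) else 0)))
    (hQχ : (mulOp sq : Module.End ℝ (g.Site → ℝ)) ∘ₗ Qp = Qp ∘ₗ (mulOp (sq ∘ blk) : Module.End ℝ (X → ℝ)))
    (hQsh : Qs ∘ₗ (mulOp hh : Module.End ℝ (g.Site → ℝ)) = (mulOp (hh ∘ blk) : Module.End ℝ (X → ℝ)) ∘ₗ Qs) :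
    HasMajorant (fun y : g.Site => y) (mulOp sq * (Qp ∘ₗ (Gw * Gw - G * G) ∘ₗ Qs) * mulOp hh)
      (fun a b => cQ * cQs * (g.L ^ 2 * (g.len a ^ 2) ^ 2 * Ctot (profileK g d δ₀ α) B₁ θ (δ - α' * δ₀) *
        Real.exp (-((δ - α' * δ₀) / 3 * M₀)) * Real.exp (-((δ - α' * δ₀) / 3 / 2 * g.dist a b)))) := by
  have hfine := B6DomainMajorant.line3_deep_majorant_lemma21 blk hρ h260 h261 hα' hRM hL hsize N hN hκδ hB₁ hθ
    (cL := sq ∘ blk) (cR := hh ∘ blk) hχ1 (fun x => hsq1 (blk x)) (fun x => hh1 (blk x)) hsqχ hhχ hχN hGD hDG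
    hχGw hGwχ hG hGw hKGw hKG (M₀ := M₀) (fun x hx => hsqdeep (blk x) hx) (fun x hx => hhdeep (blk x) hx)
  rw [cut_sandwich_eq blk (Gw * Gw - G * G) hQχ hQsh]
  refine q_sandwich_majorant blk cQ cQs hcQs (fun a b => ?_) hQ hQs hfine
  have hK0 : ∀ t : ℝ, 0 < t → 0 ≤ profileK g d δ₀ α t := fun t _ => profileK_nonneg d δ₀ α t
  have hC : 0 ≤ Ctot (profileK g d δ₀ α) B₁ θ (δ - α' * δ₀) := Ctot_nonneg hK0 hB₁ hθ (sub_pos.mpr hκδ)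
  have hL2 : 0 ≤ g.L ^ 2 := pow_nonneg (le_trans zero_le_one hL) 2
  positivity

/-- The same in KERNEL LANGUAGE: |(□Q′(G′(□̃)² − G′²)Q′\*h_□)(δ_{y′})(y)| ≤ c_Qc_{Q\*}L²(L^jη)⁴C_tot·e^{−((δ−α′δ₀)/3)M₀}·
e^{−((δ−α′δ₀)/6)d(y,y′)} — in the print's kernel convention (pairing weight (L^{j′}η)^d on 𝔅, p. 225) the left side is
the product *"(L^{j′}η)^d(Q′ ⋯ Q′\*)(y, y′)"* of the first member of (2.83). [cite: Balaban1984PropagatorsII, (2.83) p.237] -/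
theorem line3_term_entry_le (blk : X → g.Site) (hρ : IsPseudoDist g.dist) {d : ℕ} {δ₀ α α' : ℝ}
    (h260 : B6RandomWalk.Ineq260 g δ₀ α') (h261 : B6RandomWalk.Ineq261 d g δ₀ α)
    (hα' : 0 ≤ α' * δ₀) (hRM : 0 ≤ g.R * g.M) (hL : 1 ≤ g.L)
    (hsize : g.L ^ 2 * Real.exp (-(α' * δ₀ * (g.R * g.M))) ≤ 1)
    (N : Finset g.Site) (hN : N.Nonempty)
    {δ B₁ θ : ℝ} (hκδ : α' * δ₀ < δ) (hB₁ : 0 ≤ B₁) (hθ : 0 ≤ θ)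
    {G D Gw : Module.End ℝ (X → ℝ)} {χ : X → ℝ} {sq hh : g.Site → ℝ}
    (hχ1 : ∀ x, |χ x| ≤ 1) (hsq1 : ∀ y, |sq y| ≤ 1) (hh1 : ∀ y, |hh y| ≤ 1)
    (hsqχ : ∀ x, sq (blk x) * χ x = sq (blk x)) (hhχ : ∀ x, χ x * hh (blk x) = hh (blk x))
    (hχN : ∀ x, blk x ∉ N → χ x = 1)
    (hGD : G * D = 1) (hDG : D * G = 1)
    (hχGw : mulOp χ * D * Gw = mulOp χ) (hGwχ : Gw * D * mulOp χ = mulOp χ)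
    (hG : HasMajorant blk G (fun a b => B₁ * g.len a ^ 2 * Real.exp (-(δ * g.dist a b))))
    (hGw : HasMajorant blk Gw (fun a b => B₁ * g.len a ^ 2 * Real.exp (-(δ * g.dist a b))))
    (hKGw : HasMajorant blk ((mulOp χ * D - D * mulOp χ) * Gw)
      (fun a b => (if a ∈ N then θ else 0) * Real.exp (-(δ * g.dist a b))))
    (hKG : HasMajorant blk ((mulOp χ * D - D * mulOp χ) * G)
      (fun a b => (if a ∈ N then θ else 0) * Real.exp (-(δ * g.dist a b))))
    {M₀ : ℝ} (hsqdeep : ∀ y, sq y ≠ 0 → ∀ n ∈ N, M₀ ≤ g.dist y n)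
    (hhdeep : ∀ y, hh y ≠ 0 → ∀ n ∈ N, M₀ ≤ g.dist y n)
    {Qp : (X → ℝ) →ₗ[ℝ] (g.Site → ℝ)} {Qs : (g.Site → ℝ) →ₗ[ℝ] (X → ℝ)} {cQ cQs : ℝ} (hcQs : 0 ≤ cQs)
    (hQ : HasMajorantHom blk (fun y : g.Site => y) Qp (fun (a b : g.Site) => cQ * (if a = b then (1 : ℝ) else 0)))
    (hQs : HasMajorantHom (fun y : g.Site => y) blk Qs (fun (a b : g.Site) => cQs * (if a = b then (1 : ℝ) else 0)))
    (hQχ : (mulOp sq : Module.End ℝ (g.Site → ℝ)) ∘ₗ Qp = Qp ∘ₗ (mulOp (sq ∘ blk) : Module.End ℝ (X → ℝ)))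
    (hQsh : Qs ∘ₗ (mulOp hh : Module.End ℝ (g.Site → ℝ)) = (mulOp (hh ∘ blk) : Module.End ℝ (X → ℝ)) ∘ₗ Qs)
    (y y' : g.Site) :
    |entry (mulOp sq * (Qp ∘ₗ (Gw * Gw - G * G) ∘ₗ Qs) * mulOp hh) y y'| ≤
      cQ * cQs * (g.L ^ 2 * (g.len y ^ 2) ^ 2 * Ctot (profileK g d δ₀ α) B₁ θ (δ - α' * δ₀) *
        Real.exp (-((δ - α' * δ₀) / 3 * M₀)) * Real.exp (-((δ - α' * δ₀) / 3 / 2 * g.dist y y'))) :=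
  entry_le_of_hasMajorant_id (line3_term_majorant blk hρ h260 h261 hα' hRM hL hsize N hN hκδ hB₁ hθ hχ1 hsq1 hh1
    hsqχ hhχ hχN hGD hDG hχGw hGwχ hG hGw hKGw hKG hsqdeep hhdeep hcQs hQ hQs hQχ hQsh) y y'

/-- **THE (2.83)-TYPE CHAIN FOR THE THIRD LINE, members 1 ⇒ 2**: the kernel of the full third-line term
`□Q′(G′(□̃)² − G′²)Q′*h_□·C_□h_□` of (2.82) is bounded by
`c_Qc_{Q*}L²(L^jη)⁴C_tot·e^{−((δ−α′δ₀)/3)M₀} Σ_{y″} e^{−((δ−α′δ₀)/6)d(y,y″)}|C_□(y″,y′)||h_□(y′)|` — the analogue, for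
the third line, of the printed second member *"≤ O(1)(L^jη)⁴ Σ_{y″∈supp h_{□′}} e^{−½δ₀d(y,y″)} c₁(L^{j′}η)^{−d−4}
e^{−δ₁(L^{j′}η)^{−1}|y″−y′|}"* before (2.81) is inserted for |C_□(y″,y′)| (the continuation members 2 ⇒ 5 is the cell's
`B6Ineq283` at the rate (δ−α′δ₀)/6 in place of ½δ₀). [cite: Balaban1984PropagatorsII, (2.81)–(2.83) p.237] -/
theorem line3_R_entry_le (blk : X → g.Site) (hρ : IsPseudoDist g.dist) {d : ℕ} {δ₀ α α' : ℝ}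
    (h260 : B6RandomWalk.Ineq260 g δ₀ α') (h261 : B6RandomWalk.Ineq261 d g δ₀ α)
    (hα' : 0 ≤ α' * δ₀) (hRM : 0 ≤ g.R * g.M) (hL : 1 ≤ g.L)
    (hsize : g.L ^ 2 * Real.exp (-(α' * δ₀ * (g.R * g.M))) ≤ 1)
    (N : Finset g.Site) (hN : N.Nonempty)
    {δ B₁ θ : ℝ} (hκδ : α' * δ₀ < δ) (hB₁ : 0 ≤ B₁) (hθ : 0 ≤ θ)
    {G D Gw : Module.End ℝ (X → ℝ)} {χ : X → ℝ} {sq hh : g.Site → ℝ}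
    (hχ1 : ∀ x, |χ x| ≤ 1) (hsq1 : ∀ y, |sq y| ≤ 1) (hh1 : ∀ y, |hh y| ≤ 1)
    (hsqχ : ∀ x, sq (blk x) * χ x = sq (blk x)) (hhχ : ∀ x, χ x * hh (blk x) = hh (blk x))
    (hχN : ∀ x, blk x ∉ N → χ x = 1)
    (hGD : G * D = 1) (hDG : D * G = 1)
    (hχGw : mulOp χ * D * Gw = mulOp χ) (hGwχ : Gw * D * mulOp χ = mulOp χ)
    (hG : HasMajorant blk G (fun a b => B₁ * g.len a ^ 2 * Real.exp (-(δ * g.dist a b))))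
    (hGw : HasMajorant blk Gw (fun a b => B₁ * g.len a ^ 2 * Real.exp (-(δ * g.dist a b))))
    (hKGw : HasMajorant blk ((mulOp χ * D - D * mulOp χ) * Gw)
      (fun a b => (if a ∈ N then θ else 0) * Real.exp (-(δ * g.dist a b))))
    (hKG : HasMajorant blk ((mulOp χ * D - D * mulOp χ) * G)
      (fun a b => (if a ∈ N then θ else 0) * Real.exp (-(δ * g.dist a b))))
    {M₀ : ℝ} (hsqdeep : ∀ y, sq y ≠ 0 → ∀ n ∈ N, M₀ ≤ g.dist y n)
    (hhdeep : ∀ y, hh y ≠ 0 → ∀ n ∈ N, M₀ ≤ g.dist y n)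
    {Qp : (X → ℝ) →ₗ[ℝ] (g.Site → ℝ)} {Qs : (g.Site → ℝ) →ₗ[ℝ] (X → ℝ)} {cQ cQs : ℝ} (hcQs : 0 ≤ cQs)
    (hQ : HasMajorantHom blk (fun y : g.Site => y) Qp (fun (a b : g.Site) => cQ * (if a = b then (1 : ℝ) else 0)))
    (hQs : HasMajorantHom (fun y : g.Site => y) blk Qs (fun (a b : g.Site) => cQs * (if a = b then (1 : ℝ) else 0)))
    (hQχ : (mulOp sq : Module.End ℝ (g.Site → ℝ)) ∘ₗ Qp = Qp ∘ₗ (mulOp (sq ∘ blk) : Module.End ℝ (X → ℝ)))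
    (hQsh : Qs ∘ₗ (mulOp hh : Module.End ℝ (g.Site → ℝ)) = (mulOp (hh ∘ blk) : Module.End ℝ (X → ℝ)) ∘ₗ Qs)
    (C : Module.End ℝ (g.Site → ℝ)) (y y' : g.Site) :
    |entry (mulOp sq * (Qp ∘ₗ (Gw * Gw - G * G) ∘ₗ Qs) * mulOp hh * (C * mulOp hh)) y y'| ≤
      cQ * cQs * (g.L ^ 2 * (g.len y ^ 2) ^ 2 * Ctot (profileK g d δ₀ α) B₁ θ (δ - α' * δ₀) *
        Real.exp (-((δ - α' * δ₀) / 3 * M₀))) *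
        ∑ y'' : g.Site, Real.exp (-((δ - α' * δ₀) / 3 / 2 * g.dist y y'')) * (|entry C y'' y'| * |hh y'|) := by
  have h := entry_mul_le_of_majorant (C := C) (line3_term_majorant blk hρ h260 h261 hα' hRM hL hsize N hN hκδ hB₁
    hθ hχ1 hsq1 hh1 hsqχ hhχ hχN hGD hDG hχGw hGwχ hG hGw hKGw hKG hsqdeep hhdeep hcQs hQ hQs hQχ hQsh) hh y y'
  refine h.trans (le_of_eq ?_)
  rw [Finset.mul_sum]
  refine Finset.sum_congr rfl fun y'' _ => ?_
  ring

/-- **THE CONCRETE INSTANCE**: with Q′ = the normalised block average `avgOp blk w` (w ≥ 0, Σ_{B(y)}w ≤ 1) and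
Q′\* = the pull-back `pullOp blk`, the hypotheses `hQ`, `hQs`, `hQχ`, `hQsh` of `line3_term_majorant` hold BY NAME with
c_Q = c_{Q\*} = 1, so the third-line operator has the majorant L²(L^jη)⁴C_tot·e^{−((δ−α′δ₀)/3)M₀}·e^{−((δ−α′δ₀)/6)d}.
[cite: Balaban1984PropagatorsII, (2.82) p.237 + p.238] -/
theorem line3_term_majorant_avg [Fintype X] (blk : X → g.Site) (hρ : IsPseudoDist g.dist) {d : ℕ} {δ₀ α α' : ℝ}
    (h260 : B6RandomWalk.Ineq260 g δ₀ α') (h261 : B6RandomWalk.Ineq261 d g δ₀ α)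
    (hα' : 0 ≤ α' * δ₀) (hRM : 0 ≤ g.R * g.M) (hL : 1 ≤ g.L)
    (hsize : g.L ^ 2 * Real.exp (-(α' * δ₀ * (g.R * g.M))) ≤ 1)
    (N : Finset g.Site) (hN : N.Nonempty)
    {δ B₁ θ : ℝ} (hκδ : α' * δ₀ < δ) (hB₁ : 0 ≤ B₁) (hθ : 0 ≤ θ)
    {G D Gw : Module.End ℝ (X → ℝ)} {χ : X → ℝ} {sq hh : g.Site → ℝ}
    (hχ1 : ∀ x, |χ x| ≤ 1) (hsq1 : ∀ y, |sq y| ≤ 1) (hh1 : ∀ y, |hh y| ≤ 1)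
    (hsqχ : ∀ x, sq (blk x) * χ x = sq (blk x)) (hhχ : ∀ x, χ x * hh (blk x) = hh (blk x))
    (hχN : ∀ x, blk x ∉ N → χ x = 1)
    (hGD : G * D = 1) (hDG : D * G = 1)
    (hχGw : mulOp χ * D * Gw = mulOp χ) (hGwχ : Gw * D * mulOp χ = mulOp χ)
    (hG : HasMajorant blk G (fun a b => B₁ * g.len a ^ 2 * Real.exp (-(δ * g.dist a b))))
    (hGw : HasMajorant blk Gw (fun a b => B₁ * g.len a ^ 2 * Real.exp (-(δ * g.dist a b))))
    (hKGw : HasMajorant blk ((mulOp χ * D - D * mulOp χ) * Gw)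
      (fun a b => (if a ∈ N then θ else 0) * Real.exp (-(δ * g.dist a b))))
    (hKG : HasMajorant blk ((mulOp χ * D - D * mulOp χ) * G)
      (fun a b => (if a ∈ N then θ else 0) * Real.exp (-(δ * g.dist a b))))
    {M₀ : ℝ} (hsqdeep : ∀ y, sq y ≠ 0 → ∀ n ∈ N, M₀ ≤ g.dist y n)
    (hhdeep : ∀ y, hh y ≠ 0 → ∀ n ∈ N, M₀ ≤ g.dist y n)
    {w : X → ℝ} (hw0 : ∀ x, 0 ≤ w x) (hw1 : ∀ y : g.Site, (∑ x : X, if blk x = y then w x else 0) ≤ 1) :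
    HasMajorant (fun y : g.Site => y)
      (mulOp sq * (avgOp blk w ∘ₗ (Gw * Gw - G * G) ∘ₗ pullOp blk) * mulOp hh)
      (fun a b => g.L ^ 2 * (g.len a ^ 2) ^ 2 * Ctot (profileK g d δ₀ α) B₁ θ (δ - α' * δ₀) *
        Real.exp (-((δ - α' * δ₀) / 3 * M₀)) * Real.exp (-((δ - α' * δ₀) / 3 / 2 * g.dist a b))) := by
  have hQ : HasMajorantHom blk (fun y : g.Site => y) (avgOp blk w)
      (fun (a b : g.Site) => (1 : ℝ) * (if a = b then (1 : ℝ) else 0)) :=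
    hasMajorantHom_mono _ _ (hasMajorantHom_avgOp blk hw0 hw1) fun a b => by rw [one_mul]
  have hQs : HasMajorantHom (fun y : g.Site => y) blk (pullOp blk)
      (fun (a b : g.Site) => (1 : ℝ) * (if a = b then (1 : ℝ) else 0)) :=
    hasMajorantHom_mono _ _ (hasMajorantHom_pullOp blk) fun a b => by rw [one_mul]
  have h := line3_term_majorant blk hρ h260 h261 hα' hRM hL hsize N hN hκδ hB₁ hθ hχ1 hsq1 hh1 hsqχ hhχ hχN hGD
    hDG hχGw hGwχ hG hGw hKGw hKG hsqdeep hhdeep zero_le_one hQ hQs (mulOp_comp_avgOp blk w sq)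
    (pullOp_comp_mulOp blk hh)
  exact hasMajorant_mono (fun y : g.Site => y) h fun a b => by rw [one_mul, one_mul]

end Line3

end Literature.MathematicalPhysics.QuantumFieldTheory.Balaban1983to89.B6DomainMajorantSandwich
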